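import Summits.BirchSwinnertonDyer.Rank1Residual.X1.MuLambdaAlgebra
import HarnessLib

/-!
# `λ` is a congruence invariant when `μ = 0` (cell `bsd-rank2`, E1M line `cfsplit`, stub (A′) helper)

Cell `bsd-rank2` (D-0036), seat `bsd-rank2-lit` GEN 18. Planner p2 GEN 17's card for the hardest stub (A′)
`stub_depletedLawCF` of the E1M line `cfsplit` (crux `DepletedLambdaLawAtTwoMod`, route `EisensteinDepletionAtTwo`)
names «the kernel principle `μ F = μ G = 0 ∧ p ∣ F − G ⇒ λ F = λ G`, a 5-line helper anyone may land». Here it is, for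
the tree's `μ`/`λ` of `Λ = ℤ_p⟦T⟧` (`Summit.BirchSwinnertonDyer.Rank1Residual.X1.MuLambda.mu/lam/pfree/red`), any prime `p`:

* `pfree_eq_self_of_mu_eq_zero` : `μ g = 0 → pfree g = g`;
* `lam_eq_toNat_order_red_of_mu_eq_zero` : `μ g = 0 → λ g = ord_T (g mod p)`;
* `red_eq_red_of_C_dvd_sub` : `p ∣ f − g → f mod p = g mod p`;
* **`lam_eq_of_mu_eq_zero_of_C_dvd_sub`** : `μ f = 0 → μ g = 0 → C p ∣ f − g → λ f = λ g`, and the numeral form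
  **`lam_eq_of_mu_eq_zero_of_natCast_dvd_sub`** (`(p : Λ) ∣ f − g`).

(Washington, *Cyclotomic Fields* §7.1: with `μ = 0` the Weierstrass degree `λ` is the order of vanishing of the
reduction mod `p`, which only depends on `g mod p`.) PARTITION: none — r_an ≥ 2, summit axis S0; TWIN (D-0056): n/a.
B1: power-series algebra; no S0 motion. No named fact, no `sorry`.
-/

noncomputable section

namespace Summit.BirchSwinnertonDyer.Rank2

open Literature.NumberTheory.EllipticCurves
open Summit.BirchSwinnertonDyer.Rank1Residual.X1.MuLambda

section LambdaCongruence

variable {p : ℕ} [Fact p.Prime]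

/-- `μ g = 0 ⇒ pfree g = g` (`g = p^{μ g}·pfree g`). [folklore] -/
theorem pfree_eq_self_of_mu_eq_zero {g : IwasawaAlgebra p} (hμ : mu g = 0) : pfree g = g := by
  have h := eq_C_pow_mu_mul_pfree g
  rw [hμ, pow_zero, map_one, one_mul] at h
  exact h.symm

/-- `μ g = 0 ⇒ λ g = ord_T (g mod p)` (as a natural number; Washington §7.1). [folklore] -/
theorem lam_eq_toNat_order_red_of_mu_eq_zero {g : IwasawaAlgebra p} (hμ : mu g = 0) :
    lam g = (red g).order.toNat := by
  rw [lam, pfree_eq_self_of_mu_eq_zero hμ]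

/-- `C p ∣ f − g ⇒ f mod p = g mod p`. [folklore] -/
theorem red_eq_red_of_C_dvd_sub {f g : IwasawaAlgebra p} (h : PowerSeries.C (p : ℤ_[p]) ∣ f - g) :
    red f = red g := by
  have h0 : red (f - g) = 0 := (red_eq_zero_iff _).mpr h
  rwa [red, map_sub, sub_eq_zero] at h0

/-- **The kernel principle.** `μ f = 0`, `μ g = 0`, `C p ∣ f − g` in `Λ = ℤ_p⟦T⟧` ⇒ `λ f = λ g`: with `μ = 0` the
`λ`-invariant is the order of vanishing of the reduction mod `p`, a function of `f mod p` alone (Washington §7.1).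
No non-vanishing hypothesis is needed (the tree's junk values agree). [folklore] -/
theorem lam_eq_of_mu_eq_zero_of_C_dvd_sub {f g : IwasawaAlgebra p} (hμf : mu f = 0) (hμg : mu g = 0)
    (h : PowerSeries.C (p : ℤ_[p]) ∣ f - g) : lam f = lam g := by
  rw [lam_eq_toNat_order_red_of_mu_eq_zero hμf, lam_eq_toNat_order_red_of_mu_eq_zero hμg,
    red_eq_red_of_C_dvd_sub h]

/-- The same with the numeral `(p : Λ) ∣ f − g`. [folklore] -/
theorem lam_eq_of_mu_eq_zero_of_natCast_dvd_sub {f g : IwasawaAlgebra p} (hμf : mu f = 0) (hμg : mu g = 0)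
    (h : (p : IwasawaAlgebra p) ∣ f - g) : lam f = lam g := by
  refine lam_eq_of_mu_eq_zero_of_C_dvd_sub hμf hμg ?_
  rwa [map_natCast]

end LambdaCongruence

end Summit.BirchSwinnertonDyer.Rank2

end
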